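import Literature.Probability.LatticeModels.MedialTrailUmlaufsatz
import HarnessLib

/-!
# Closed corner trails of `ℤ²`: realisation as cycles of the turning rule, the signed Umlaufsatz,
# and the winding of an exploration prefix closed by a virtual path

Topic `Literature/Probability/LatticeModels`; a companion of `MedialTrailUmlaufsatz.lean` (the
combinatorial Umlaufsatz with the sign of the winding number for closed trails of the oriented
medial graph, `MedialTrail.inv_of_isTrail`, exported to cycles of the turning rule `nextCorner β` as
`inv_cornerOrbit`). The spin-`σ` parafermionic observable of a medial exploration weighs the passage
through a dart by `exp (-i σ W)`, `W = (π/2) · turnCount` the winding of the exploration PREFIX from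
the start dart; along a boundary arc this winding is deterministic ("since the edge `e` is along the
free arc, the winding `W_γ(e_a, e)` of the exploration path at `e` is constant", Duminil-Copin–
Hongler–Nolin 2011, Lemma 12; Duminil-Copin–Smirnov 2012, Prop. 7.8; for `σ = 1/2` the tree's
`FKFreeArcPhase.lean` does the bottom-row case by Hopf's Umlaufsatz for the perturbed polygon). This
file supplies the configuration-free combinatorial tool behind all such statements:

* `leftSucc`, `rightSucc` — the two successors of a corner (cross the target edge / follow it);
  `IsCornerTrail c Q` — a CLOSED CORNER TRAIL: `Q ≥ 1` corners `c 0, …, c (Q-1)`, pairwise distinct,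
  each followed by one of its two successors, closing up (`c Q = c 0`); `trailSign c m = ∓1` for a
  right/left step; `trailConfig c Q` — the bond configuration opening exactly the target edges that
  are followed.
* `IsCornerTrail.cornerOrbit_trailConfig` — **every closed corner trail is a cycle of minimal period
  of the turning rule** of `trailConfig c Q` (two distinct corners arriving at one edge are partners,
  and a trail that used the edge in both ways would repeat a corner); hence
  `IsCornerTrail.inv` — `∑_{m<Q} trailSign c m = 4` with winding numbers in `{0, 1}`, or `= -4` with
  winding numbers in `{0, -1}` (`inv_cornerOrbit`).
* **Sign pinning by an extreme dart**: `IsCornerTrail.sum_trailSign_eq_four_of_west` /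
  `…_eq_neg_four_of_west` / `…_of_east` — a southward (face index `2`) dart in the westmost medial
  column forces `+4` (counter-clockwise), a northward one (face index `0`) forces `-4`, and dually on
  the eastmost column.
* The application to exploration prefixes (`turnCount β c₀ j = ±4 - ∑_{j ≤ m < Q} trailSign c m`
  for a closed corner trail `c` extending the first `j` steps of the orbit of `c₀` — a "virtual"
  closing path using no configuration at all) is the sequel `MedialExplorationPrefixWinding.lean`.

Everything is proved; the inputs are `inv_of_isTrail` / `isTrail_cornerOrbit` / `cpos_nextCorner`
(tree) and `cTgt_eq_cTgt_iff` (`CornerPermutation.lean`).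

## References

* H. Hopf, *Über die Drehung der Tangenten und Sehnen ebener Kurven*, Compositio Math. 2 (1935),
  Satz I. [Hopf1935]
* H. Duminil-Copin, C. Hongler, P. Nolin, Comm. Pure Appl. Math. 64 (2011), Lemma 12.
  [DuminilCopinHonglerNolin2011]
* S. Smirnov, Ann. of Math. 172 (2010), §4 (the turning rule, Fig. 5). [Smirnov2010]
-/

namespace Literature.Probability.LatticeModels

open MedialTrail Finset

/-! ### The two successors of a corner -/

/-- The LEFT successor of the corner `(v, k)`: cross the target edge and turn counter-clockwise around
`v` into the next face, `(v, k + 1)` (`nextCorner` across a closed edge). [cite: Smirnov2010, §4] -/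
def leftSucc (p : Site 2 × Fin 4) : Site 2 × Fin 4 := (p.1, p.2 + 1)

/-- The RIGHT successor of the corner `(v, k)`: follow the target edge inside the face,
`(v + u_{k+1}, k + 3)` (`nextCorner` along an open edge). [cite: Smirnov2010, §4] -/
def rightSucc (p : Site 2 × Fin 4) : Site 2 × Fin 4 := (p.1 + cornerUnit (p.2 + 1), p.2 + 3)

/-- Along an open target edge the turning rule takes the right successor. [cite: Smirnov2010, §4] -/
theorem nextCorner_eq_rightSucc {β : Percolation.BondConfig (Site 2)} {p : Site 2 × Fin 4}
    (h : cTgt p ∈ β) : nextCorner β p = rightSucc p :=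
  nextCorner_of_mem h

/-- Across a closed target edge the turning rule takes the left successor. [cite: Smirnov2010, §4] -/
theorem nextCorner_eq_leftSucc {β : Percolation.BondConfig (Site 2)} {p : Site 2 × Fin 4}
    (h : cTgt p ∉ β) : nextCorner β p = leftSucc p :=
  nextCorner_of_not_mem h

/-- The turning rule always takes one of the two successors. [cite: Smirnov2010, §4] -/
theorem nextCorner_eq_or (β : Percolation.BondConfig (Site 2)) (p : Site 2 × Fin 4) :
    nextCorner β p = leftSucc p ∨ nextCorner β p = rightSucc p := by
  by_cases h : cTgt p ∈ β
  · exact Or.inr (nextCorner_eq_rightSucc h)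
  · exact Or.inl (nextCorner_eq_leftSucc h)

/-- The two successors differ (their face indices differ by `2`). [folklore] -/
theorem leftSucc_ne_rightSucc (p : Site 2 × Fin 4) : leftSucc p ≠ rightSucc p := by
  intro h
  have h2 := congrArg Prod.snd h
  simp only [leftSucc, rightSucc] at h2
  have : ∀ k : Fin 4, k + 1 ≠ k + 3 := by decide
  exact this _ h2

/-- The right successor of the partner corner (the other corner arriving at the same edge) is the
left successor of the corner: both enter the face across the edge. [cite: Smirnov2010, proof of Lemma 4.5] -/
theorem rightSucc_cornerPartner (p : Site 2 × Fin 4) : rightSucc (cornerPartner p) = leftSucc p := by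
  obtain ⟨v, k⟩ := p
  simp only [rightSucc, cornerPartner, leftSucc, Prod.mk.injEq]
  have h5 : ∀ k : Fin 4, k + 2 + 3 = k + 1 := by decide
  have h3 : ∀ k : Fin 4, k + 2 + 1 = (k + 1) + 2 := by decide
  refine ⟨?_, h5 k⟩
  rw [h3, cornerUnit_add_two]
  abel

/-- The turn sign read off the successor: `-1` along the right successor. [cite: Smirnov2010, §4] -/
theorem turnSign_eq_neg_one_iff (β : Percolation.BondConfig (Site 2)) (p : Site 2 × Fin 4) :
    turnSign β p = -1 ↔ nextCorner β p = rightSucc p := by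
  by_cases h : cTgt p ∈ β
  · simp [turnSign_of_mem h, nextCorner_eq_rightSucc h]
  · rw [turnSign_of_not_mem h, nextCorner_eq_leftSucc h]
    simp [leftSucc_ne_rightSucc p]

/-! ### Closed corner trails and their realisation as cycles of the turning rule -/

/-- **Closed corner trail.** `Q ≥ 1` corners `c 0, …, c (Q - 1)`, pairwise distinct, each followed
(`c (m + 1)`, with `c Q = c 0` closing up) by its left or its right successor: a closed trail of the
oriented medial graph in corner coordinates, traversable by the turning rule of a suitable
configuration (`IsCornerTrail.cornerOrbit_trailConfig`). Only the values `c 0, …, c Q` matter.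
[cite: Smirnov2010, §4] -/
structure IsCornerTrail (c : ℕ → Site 2 × Fin 4) (Q : ℕ) : Prop where
  /-- The trail has at least one dart. -/
  pos : 0 < Q
  /-- The trail closes up. -/
  periodic : c Q = c 0
  /-- Each corner is followed by one of its two successors. -/
  step : ∀ m < Q, c (m + 1) = leftSucc (c m) ∨ c (m + 1) = rightSucc (c m)
  /-- The `Q` corners are pairwise distinct. -/
  injOn : ∀ i j, i < Q → j < Q → c i = c j → i = j

/-- The sign of the `m`-th turn of a corner sequence: `-1` (right) if the next corner is the right
successor, `+1` (left) otherwise. [cite: Smirnov2010, §4] -/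
noncomputable def trailSign (c : ℕ → Site 2 × Fin 4) (m : ℕ) : ℤ :=
  by classical exact if c (m + 1) = rightSucc (c m) then -1 else 1

/-- The configuration REALISING a corner sequence of length `Q`: exactly the target edges that are
followed (right turns) are open. [cite: Smirnov2010, §4] -/
def trailConfig (c : ℕ → Site 2 × Fin 4) (Q : ℕ) : Percolation.BondConfig (Site 2) :=
  {e | ∃ m < Q, cTgt (c m) = e ∧ c (m + 1) = rightSucc (c m)}

namespace IsCornerTrail

variable {c : ℕ → Site 2 × Fin 4} {Q : ℕ}

/-- Indices `≤ Q` with equal corners are equal modulo the closing identification `Q ∼ 0`.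
[folklore] -/
theorem eq_of_eq_succ (h : IsCornerTrail c Q) {m m' : ℕ} (hm : m < Q) (hm' : m' < Q)
    (he : c (m + 1) = c (m' + 1)) : m = m' := by
  -- reduce both indices modulo `Q`
  have red : ∀ n < Q, ∃ r < Q, c (n + 1) = c r ∧ (r = n + 1 ∨ (n + 1 = Q ∧ r = 0)) := by
    intro n hn
    rcases Nat.lt_or_ge (n + 1) Q with h1 | h1
    · exact ⟨n + 1, h1, rfl, Or.inl rfl⟩
    · have hQ : n + 1 = Q := by omega
      exact ⟨0, h.pos, by rw [hQ, h.periodic], Or.inr ⟨hQ, rfl⟩⟩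
  obtain ⟨r, hr, hcr, hr'⟩ := red m hm
  obtain ⟨r', hr'', hcr', hr'''⟩ := red m' hm'
  have hrr : r = r' := h.injOn r r' hr hr'' (by rw [← hcr, ← hcr', he])
  rcases hr' with rfl | ⟨h1, rfl⟩ <;> rcases hr''' with h2 | ⟨h3, h4⟩ <;> omega

/-- **The realising configuration reproduces the steps**: for `m < Q`, the target edge of `c m` is
open in `trailConfig c Q` iff the trail follows it. Two distinct corners arriving at one edge are
partners (`cTgt_eq_cTgt_iff`), the partner's right successor is the corner's left successor, and the
trail cannot take the same corner twice. [cite: Smirnov2010, proof of Lemma 4.5] -/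
theorem cTgt_mem_trailConfig_iff (h : IsCornerTrail c Q) {m : ℕ} (hm : m < Q) :
    cTgt (c m) ∈ trailConfig c Q ↔ c (m + 1) = rightSucc (c m) := by
  constructor
  · rintro ⟨m', hm', he, hright⟩
    rcases cTgt_eq_cTgt_iff.1 he with heq | hpartner
    · obtain rfl : m' = m := h.injOn m' m hm' hm heq
      exact hright
    · rw [hpartner, rightSucc_cornerPartner] at hright
      rcases h.step m hm with hleft | hright'
      · exact absurd (h.eq_of_eq_succ hm hm' (hleft.trans hright.symm)) fun hmm =>
          partner_ne (c m) (by rw [← hpartner, hmm])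
      · exact hright'
  · intro hright
    exact ⟨m, hm, rfl, hright⟩

/-- The turn sign of the realising configuration at `c m` is `trailSign c m`. [cite: Smirnov2010, §4] -/
theorem turnSign_trailConfig (h : IsCornerTrail c Q) {m : ℕ} (hm : m < Q) :
    turnSign (trailConfig c Q) (c m) = trailSign c m := by
  classical
  unfold trailSign
  by_cases hr : c (m + 1) = rightSucc (c m)
  · rw [if_pos hr, turnSign_of_mem ((h.cTgt_mem_trailConfig_iff hm).2 hr)]
  · rw [if_neg hr, turnSign_of_not_mem (fun hmem => hr ((h.cTgt_mem_trailConfig_iff hm).1 hmem))]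

/-- The turning rule of the realising configuration steps along the trail. [cite: Smirnov2010, §4] -/
theorem nextCorner_trailConfig (h : IsCornerTrail c Q) {m : ℕ} (hm : m < Q) :
    nextCorner (trailConfig c Q) (c m) = c (m + 1) := by
  rcases h.step m hm with hl | hr
  · rw [hl, nextCorner_eq_leftSucc]
    intro hmem
    exact leftSucc_ne_rightSucc _ (hl.symm.trans ((h.cTgt_mem_trailConfig_iff hm).1 hmem))
  · rw [hr, nextCorner_eq_rightSucc ((h.cTgt_mem_trailConfig_iff hm).2 hr)]

/-- **A closed corner trail is the orbit of its first corner** under the turning rule of the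
realising configuration. [cite: Smirnov2010, §4] -/
theorem cornerOrbit_trailConfig (h : IsCornerTrail c Q) :
    ∀ m ≤ Q, cornerOrbit (trailConfig c Q) (c 0) m = c m := by
  intro m
  induction m with
  | zero => intro; rfl
  | succ m ih =>
    intro hm
    change nextCorner (trailConfig c Q) (cornerOrbit (trailConfig c Q) (c 0) m) = c (m + 1)
    rw [ih (by omega), h.nextCorner_trailConfig (by omega)]

/-- The orbit closes up after `Q` steps. [cite: Smirnov2010, §4] -/
theorem cornerOrbit_trailConfig_period (h : IsCornerTrail c Q) :
    cornerOrbit (trailConfig c Q) (c 0) Q = c 0 := by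
  rw [h.cornerOrbit_trailConfig Q le_rfl, h.periodic]

/-- `Q` is the minimal period of the orbit. [cite: Smirnov2010, §4] -/
theorem cornerOrbit_trailConfig_ne (h : IsCornerTrail c Q) :
    ∀ s, 0 < s → s < Q → cornerOrbit (trailConfig c Q) (c 0) s ≠ c 0 := by
  intro s hs hsQ heq
  rw [h.cornerOrbit_trailConfig s hsQ.le] at heq
  have := h.injOn s 0 hsQ h.pos heq
  omega

/-- The coded point list of the trail is that of the realising orbit. [folklore] -/
theorem map_cpos_eq (h : IsCornerTrail c Q) :
    ((List.range Q).map fun m => cpos (cornerOrbit (trailConfig c Q) (c 0) m)) =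
      (List.range Q).map fun m => cpos (c m) := by
  refine List.map_congr_left fun m hm => ?_
  rw [List.mem_range] at hm
  rw [h.cornerOrbit_trailConfig m hm.le]

/-- The sum of the turn signs of the realising orbit is `∑ trailSign`. [folklore] -/
theorem sum_turnSign_eq (h : IsCornerTrail c Q) :
    ∑ m ∈ range Q, turnSign (trailConfig c Q) (cornerOrbit (trailConfig c Q) (c 0) m) =
      ∑ m ∈ range Q, trailSign c m := by
  refine sum_congr rfl fun m hm => ?_
  rw [mem_range] at hm
  rw [h.cornerOrbit_trailConfig m hm.le, h.turnSign_trailConfig hm]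

/-- **The coded point list of a closed corner trail is a closed trail of the oriented medial graph.**
[cite: Smirnov2010, §4, Fig. 5] -/
theorem isTrail (h : IsCornerTrail c Q) : IsTrail ((List.range Q).map fun m => cpos (c m)) := by
  rw [← h.map_cpos_eq]
  exact isTrail_cornerOrbit h.pos h.cornerOrbit_trailConfig_period h.cornerOrbit_trailConfig_ne

/-- **Signed Umlaufsatz for closed corner trails**: the turn signs sum to `4` and the winding number
of the coded trail around every medial face is `0` or `1` (a counter-clockwise trail), or they sum to
`-4` and the winding number is everywhere `0` or `-1` (a clockwise trail). [cite: Hopf1935, Satz I] -/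
theorem inv (h : IsCornerTrail c Q) :
    (∑ m ∈ range Q, trailSign c m = 4 ∧
        ∀ F, wnd ((List.range Q).map fun m => cpos (c m)) F = 0 ∨
          wnd ((List.range Q).map fun m => cpos (c m)) F = 1) ∨
      (∑ m ∈ range Q, trailSign c m = -4 ∧
        ∀ F, wnd ((List.range Q).map fun m => cpos (c m)) F = 0 ∨
          wnd ((List.range Q).map fun m => cpos (c m)) F = -1) := by
  rw [← h.sum_turnSign_eq, ← h.map_cpos_eq]
  exact inv_cornerOrbit h.pos h.cornerOrbit_trailConfig_period h.cornerOrbit_trailConfig_ne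

/-- The turn signs of a closed corner trail sum to `±4`. [cite: Hopf1935, Satz I] -/
theorem sum_trailSign_eq_or (h : IsCornerTrail c Q) :
    ∑ m ∈ range Q, trailSign c m = 4 ∨ ∑ m ∈ range Q, trailSign c m = -4 := by
  rcases h.inv with ⟨h4, -⟩ | ⟨h4, -⟩
  · exact Or.inl h4
  · exact Or.inr h4

/-! ### Pinning the sign by an extreme dart -/

/-- The coded step of the trail at `m < Q`: the medial coordinates move by `cdir (c m).2`.
[cite: Smirnov2010, §4] -/
theorem cpos_succ (h : IsCornerTrail c Q) {m : ℕ} (hm : m < Q) :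
    cpos (c (m + 1)) = ((cpos (c m)).1 + (cdir (c m).2).1, (cpos (c m)).2 + (cdir (c m).2).2) := by
  rw [← h.nextCorner_trailConfig hm, cpos_nextCorner]

/-- The `m`-th coded dart belongs to the cyclic dart list of the trail. [folklore] -/
theorem mem_cdarts (h : IsCornerTrail c Q) {m : ℕ} (hm : m < Q) :
    (cpos (c m), cpos (c (m + 1))) ∈ cdarts ((List.range Q).map fun m => cpos (c m)) := by
  have hper : (fun m => cpos (c m)) Q = (fun m => cpos (c m)) 0 := by simp only [h.periodic]
  rw [cdarts_map_range _ hper, List.mem_map]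
  exact ⟨m, List.mem_range.2 hm, rfl⟩

/-- Points of the coded trail are the `cpos (c m)`, `m < Q`. [folklore] -/
theorem exists_of_mem_map {P : Pt} (hP : P ∈ (List.range Q).map fun m => cpos (c m)) :
    ∃ m < Q, P = cpos (c m) := by
  rw [List.mem_map] at hP
  obtain ⟨m, hm, rfl⟩ := hP
  exact ⟨m, List.mem_range.1 hm, rfl⟩

/-- A dart of the trail whose RIGHT face has winding number `0` makes the trail counter-clockwise:
its left face then has winding number `1`. [cite: Hopf1935, Satz I] -/
theorem sum_trailSign_eq_four_of_wnd_rf (h : IsCornerTrail c Q) {d : Pt × Pt}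
    (hd : d ∈ cdarts ((List.range Q).map fun m => cpos (c m)))
    (h0 : wnd ((List.range Q).map fun m => cpos (c m)) (rf d) = 0) :
    ∑ m ∈ range Q, trailSign c m = 4 := by
  have h1 := h.isTrail.wnd_lf hd
  rw [h0, zero_add] at h1
  rcases h.inv with ⟨h4, -⟩ | ⟨-, hw⟩
  · exact h4
  · rcases hw (lf d) with h' | h' <;> rw [h1] at h' <;> simp at h'

/-- A dart of the trail whose LEFT face has winding number `0` makes the trail clockwise: its right
face then has winding number `-1`. [cite: Hopf1935, Satz I] -/
theorem sum_trailSign_eq_neg_four_of_wnd_lf (h : IsCornerTrail c Q) {d : Pt × Pt}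
    (hd : d ∈ cdarts ((List.range Q).map fun m => cpos (c m)))
    (h0 : wnd ((List.range Q).map fun m => cpos (c m)) (lf d) = 0) :
    ∑ m ∈ range Q, trailSign c m = -4 := by
  have h1 := h.isTrail.wnd_lf hd
  rw [h0] at h1
  rcases h.inv with ⟨-, hw⟩ | ⟨h4, -⟩
  · rcases hw (rf d) with h' | h' <;> omega
  · exact h4

/-- **Westmost southward dart ⇒ counter-clockwise.** If some dart of the trail has face index `2`
(it points south in medial coordinates) and no point of the trail lies strictly west of it, the turn
signs sum to `+4` (the face west of the dart, on its right, has winding number `0`).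
[cite: Hopf1935, Satz I] -/
theorem sum_trailSign_eq_four_of_west (h : IsCornerTrail c Q) {m₀ : ℕ} (hm₀ : m₀ < Q)
    (h2 : (c m₀).2 = 2) (hwest : ∀ m < Q, (cpos (c m₀)).1 ≤ (cpos (c m)).1) :
    ∑ m ∈ range Q, trailSign c m = 4 := by
  have hstep := h.cpos_succ hm₀
  rw [h2] at hstep
  simp only [cdir, Matrix.cons_val] at hstep
  refine h.sum_trailSign_eq_four_of_wnd_rf (h.mem_cdarts hm₀) ?_
  have hrf : rf (cpos (c m₀), cpos (c (m₀ + 1))) = ((cpos (c m₀)).1 - 1, (cpos (c m₀)).2 - 1) := by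
    rw [hstep]; simp only [rf]; split_ifs <;> first | rfl | (exfalso; omega)
  rw [hrf]
  refine wnd_eq_zero_of_lt fun P hP => ?_
  obtain ⟨m, hm, rfl⟩ := exists_of_mem_map hP
  have := hwest m hm
  omega

/-- **Westmost northward dart ⇒ clockwise.** If some dart of the trail has face index `0` (it points
north in medial coordinates) and no point of the trail lies strictly west of it, the turn signs sum to
`-4` (the face west of the dart, on its left, has winding number `0`). [cite: Hopf1935, Satz I] -/
theorem sum_trailSign_eq_neg_four_of_west (h : IsCornerTrail c Q) {m₀ : ℕ} (hm₀ : m₀ < Q)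
    (h0 : (c m₀).2 = 0) (hwest : ∀ m < Q, (cpos (c m₀)).1 ≤ (cpos (c m)).1) :
    ∑ m ∈ range Q, trailSign c m = -4 := by
  have hstep := h.cpos_succ hm₀
  rw [h0] at hstep
  simp only [cdir, Matrix.cons_val] at hstep
  refine h.sum_trailSign_eq_neg_four_of_wnd_lf (h.mem_cdarts hm₀) ?_
  have hlf : lf (cpos (c m₀), cpos (c (m₀ + 1))) = ((cpos (c m₀)).1 - 1, (cpos (c m₀)).2) := by
    rw [hstep]; simp only [lf]; split_ifs <;> rfl
  rw [hlf]
  refine wnd_eq_zero_of_lt fun P hP => ?_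
  obtain ⟨m, hm, rfl⟩ := exists_of_mem_map hP
  have := hwest m hm
  omega

/-- **Eastmost northward dart ⇒ counter-clockwise** (the face east of the dart, on its right, has
winding number `0`: zero flux through its row). [cite: Hopf1935, Satz I] -/
theorem sum_trailSign_eq_four_of_east (h : IsCornerTrail c Q) {m₀ : ℕ} (hm₀ : m₀ < Q)
    (h0 : (c m₀).2 = 0) (heast : ∀ m < Q, (cpos (c m)).1 ≤ (cpos (c m₀)).1) :
    ∑ m ∈ range Q, trailSign c m = 4 := by
  have hstep := h.cpos_succ hm₀
  rw [h0] at hstep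
  simp only [cdir, Matrix.cons_val] at hstep
  refine h.sum_trailSign_eq_four_of_wnd_rf (h.mem_cdarts hm₀) ?_
  have hrf : rf (cpos (c m₀), cpos (c (m₀ + 1))) = ((cpos (c m₀)).1, (cpos (c m₀)).2) := by
    rw [hstep]; simp only [rf]; split_ifs <;> rfl
  rw [hrf]
  refine wnd_eq_zero_of_ge h.isTrail.2.2 fun P hP => ?_
  obtain ⟨m, hm, rfl⟩ := exists_of_mem_map hP
  exact heast m hm

/-- **Eastmost southward dart ⇒ clockwise** (the face east of the dart, on its left, has winding
number `0`). [cite: Hopf1935, Satz I] -/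
theorem sum_trailSign_eq_neg_four_of_east (h : IsCornerTrail c Q) {m₀ : ℕ} (hm₀ : m₀ < Q)
    (h2 : (c m₀).2 = 2) (heast : ∀ m < Q, (cpos (c m)).1 ≤ (cpos (c m₀)).1) :
    ∑ m ∈ range Q, trailSign c m = -4 := by
  have hstep := h.cpos_succ hm₀
  rw [h2] at hstep
  simp only [cdir, Matrix.cons_val] at hstep
  refine h.sum_trailSign_eq_neg_four_of_wnd_lf (h.mem_cdarts hm₀) ?_
  have hlf : lf (cpos (c m₀), cpos (c (m₀ + 1))) = ((cpos (c m₀)).1, (cpos (c m₀)).2 - 1) := by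
    rw [hstep]; simp only [lf]; split_ifs <;> first | rfl | (exfalso; omega)
  rw [hlf]
  refine wnd_eq_zero_of_ge h.isTrail.2.2 fun P hP => ?_
  obtain ⟨m, hm, rfl⟩ := exists_of_mem_map hP
  exact heast m hm

end IsCornerTrail

end Literature.Probability.LatticeModels
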